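import Mathlib
import Summits.NavierStokesRegularity.NavierStokesRegularity.Theorems.TypeIQuarterGateScarEnvelopeTypeIZoomDictionaryDefs
import Summits.NavierStokesRegularity.NavierStokesRegularity.Theorems.TypeIQuarterGateScarEnvelopeTypeIFatKill
import Summits.NavierStokesRegularity.NavierStokesRegularity.Theorems.TypeIQuarterGateScarEnvelopeTypeIBudgetViolators
import Summits.NavierStokesRegularity.NavierStokesRegularity.Theorems.TypeIQuarterGateScarEnvelopeTypeIOfNoTwinScarObject
import Summits.NavierStokesRegularity.NavierStokesRegularity.Theorems.TypeIQuarterGateQuarterLawTypeIGlue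
import Summits.NavierStokesRegularity.NavierStokesRegularity.Theorems.TypeIQuarterGateEnvelopeQuarterLaw
import Summits.NavierStokesRegularity.NavierStokesRegularity.Theorems.TypeIQuarterGateScarEnvelopeTypeINearOneRateDss

/-!
# Satellite tower for crux `ScarEnvelopeTypeI` (stmt-NavierStokesRegularity-23843) — DEFINITIONS (Part K)

DEFINITIONS ONLY (Part K of the plate, ROUND-31 prep «the satellite tower»): the time shift `tshift`, tower
objects `TowerObj`, the engine class `ABTower`, `satellites`/`TameSatellite`, the typed tower statements
`TowerRooted`/`TowerClosed`/`TowerPersists` (fact-shaped `Prop`s; T1/T2/T0 are PROVED in the theorem files),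
tower nodes `TNode`/`TowerNode`/`TameNode`/`Descends`/`RootedNode`.  Nothing is asserted here.

PROVENANCE: declaration texts VERBATIM from the HOME plate `round-31/Tangent31prep.lean` v4 (sha16
`013b26365b5cdf0a`, + K12 of v5 `e5b8668e3a090216`; = ROUND-30 plate v10 + Part K) of the instrument seat nsreg-p3 (g24/g25, cell
`pub/ns-regularity-ideate`), who cannot write under `Theorems/` (`perm.theorems-prover-only`); landed by the
LEAD-lineage prover ns-sz-p1 g5 on director-ns DIRECTOR-NS #218 (2), split into ≤ 400-line modules (the
plate's `def`s gathered in `TypeIQuarterGateScarEnvelopeTypeIZoomDictionaryDefs`), namespace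
`Summit.NavierStokesRegularity.NavierStokesRegularity.Cruxes.ScarEnvelopeTypeI.ZoomDictionary` (the plate's `NsregP3.R30P`), `E3` spelled out, one-line docstrings
added where the plate had none.  `--supports stmt-NavierStokesRegularity-23843 --as helper`.
REVIEW p632872 (revise) applied: only the dependency cone of Parts D–K is landed (206 of 240 declarations) —
the general-`ν` abstract dictionary in a second cylinder currency (`bCyl`/`bCylOpens`/`RegAt`/`TangentC`, the
fact-shaped hypotheses F1–F3 and `dictionary`/`…_of_vertexBounds`/`…_of_classical` of Parts B2/B4/C) is NOT
landed; the three remaining uses of the plate's `bCyl y r` are the literal `Ioo (-(r^2)) 0 ×ˢ ball y r` with the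
conversion `Ioo_prod_ball_eq_parabolicCylinder` to the tree's `parabolicCylinder`; ONE final-time regularity
notion `RegPt`; `zoom_eq_smul_stPull`/`zoomP_eq_smul_stPull` sit next to `zoom`/`zoomP` in the Defs module.

HONEST FRAMING: dictionary / census TOOLING for the crux `TypeIQuarterGate.ScarEnvelopeTypeI` (item 23843):
equivalences and normal forms, kernel-checked; NO open statement is proved — 23843, its parent
`QuarterLawTypeI` (23726), the route and Navier–Stokes regularity are OPEN; hard core evaded: none.
-/

noncomputable section

-- the summit-side namespace repeats a component by design (single-conjunct summit, D-0017)
set_option linter.dupNamespace false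

open MeasureTheory Set Metric Filter Topology
open scoped ENNReal

namespace Summit.NavierStokesRegularity.NavierStokesRegularity.Cruxes.ScarEnvelopeTypeI.ZoomDictionary

variable {u : ℝ → (EuclideanSpace ℝ (Fin 3)) → (EuclideanSpace ℝ (Fin 3))} {a : (EuclideanSpace ℝ (Fin 3))} {ν T : ℝ}

section Tower

open Literature.Analysis.FluidPDE
variable {U : ℝ → (EuclideanSpace ℝ (Fin 3)) → (EuclideanSpace ℝ (Fin 3))} {P : ℝ → (EuclideanSpace ℝ (Fin 3)) → ℝ} {y' : (EuclideanSpace ℝ (Fin 3))} {ν : ℝ}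

/-- Time shift placing the final time `0` of an ancient flow at `T = 1`: `(tshift U) s = U (s - 1)`. -/
def tshift {F : Type*} (U : ℝ → (EuclideanSpace ℝ (Fin 3)) → F) : ℝ → (EuclideanSpace ℝ (Fin 3)) → F := fun s x => U (s - 1) x

/-- **Tower object** with rate `M` and inherited bound `K`: `(U, P)` is a suitable weak solution in
every parabolic ball `Q_a(0)` (A–B Def. 2.1), `U` is continuous on the open past `{s < 0}`, obeys
the Type-I rate `|U(s,x)| ≤ M/√(-s)`, and has PLAIN scaled bounds `C(r; z) ≤ K`, `D(r; z) ≤ K` at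
every FINAL-TIME apex `(0, y')` and every radius `r ≤ 1`, the bound depending on the point (the
conclusion shape of the tree's `blowup_cknC_le_apex` / `blowup_cknD_le_apex`, restricted to what the
dictionary consumes). -/
def TowerObj (M : ℝ) (U : ℝ → (EuclideanSpace ℝ (Fin 3)) → (EuclideanSpace ℝ (Fin 3))) (P : ℝ → (EuclideanSpace ℝ (Fin 3)) → ℝ) : Prop :=
  (∀ a : ℝ, 0 < a → IsSuitableWeakSolutionInBall a (0 : ℝ × (EuclideanSpace ℝ (Fin 3))) U P) ∧
    ContinuousOn (Function.uncurry U) (Iio 0 ×ˢ univ) ∧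
    HasTypeITimeDecay M U ∧
    ∀ y' : (EuclideanSpace ℝ (Fin 3)), ∃ K : NNReal, ∀ r : ℝ, 0 < r → r ≤ 1 →
      cknC r (((0 : ℝ), y') : ℝ × (EuclideanSpace ℝ (Fin 3))) U ≤ K ∧ cknD r (((0 : ℝ), y') : ℝ × (EuclideanSpace ℝ (Fin 3))) P ≤ K

/-- The engine class (cf. the conclusion of `exists_typeIAncientMild_twinZoomLimit_budget`). -/
def ABTower (M : ℝ) (U : ℝ → (EuclideanSpace ℝ (Fin 3)) → (EuclideanSpace ℝ (Fin 3))) (P : ℝ → (EuclideanSpace ℝ (Fin 3)) → ℝ) (H : ℝ → (EuclideanSpace ℝ (Fin 3)) → (EuclideanSpace ℝ (Fin 3)) →L[ℝ] (EuclideanSpace ℝ (Fin 3))) : Prop :=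
  IsTypeIAncientMild M U ∧
    (∀ a : ℝ, 0 < a → IsSuitableWeakSolutionInBall a (0 : ℝ × (EuclideanSpace ℝ (Fin 3))) U P) ∧
    HasWeakSpatialGradientOn (slab (EuclideanSpace ℝ (Fin 3)) (Iio 0) isOpen_Iio) U H ∧
    typeIBound (Iio (0 : ℝ) ×ˢ univ) U P H < ⊤

/-- The **satellites** of an ancient flow: its final-time points other than the origin near which
it is not essentially bounded. -/
def satellites (U : ℝ → (EuclideanSpace ℝ (Fin 3)) → (EuclideanSpace ℝ (Fin 3))) : Set (EuclideanSpace ℝ (Fin 3)) := {y' | y' ≠ 0 ∧ ¬ RegPt U y'}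

/-- A satellite is **tame** when the slice budget of `U` holds there (by `towerDictionary_inBall`:
iff all tangent flows of `U` at it are satellite-free in the unit ball). -/
def TameSatellite (U : ℝ → (EuclideanSpace ℝ (Fin 3)) → (EuclideanSpace ℝ (Fin 3))) (y' : (EuclideanSpace ℝ (Fin 3))) : Prop := y' ∈ satellites U ∧ BudgetAt 1 0 U y'

/-- (T0) **Rooting** (target): under the crux hypotheses at `ν = 1`, every tangent flow of the
blow-up solution at a final-time singular point agrees a.e. on every `Q_R(0)`, `R < 1`, with a tower
object.  Engines: tree `exists_typeIAncientMild_twinZoomLimit_budget` (mild Type-I ancient limit),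
`blowup_cknC_le_apex`, `blowup_cknD_le_apex` (inherited plain bounds), Part E (vertex bounds). -/
def TowerRooted (M : ℝ) : Prop :=
  ∀ (T : ℝ) (u : ℝ → (EuclideanSpace ℝ (Fin 3)) → (EuclideanSpace ℝ (Fin 3))) (p : ℝ → (EuclideanSpace ℝ (Fin 3)) → ℝ),
    Summit.NavierStokesRegularity.NavierStokesRegularity.Cruxes.ScarEnvelopeTypeI.ScarZoom.CruxHypotheses
        1 T u p →
    ∀ (a : (EuclideanSpace ℝ (Fin 3))) (q : ℝ → (EuclideanSpace ℝ (Fin 3)) → ℝ), ZoomsInBall u q a T → ZoomsBddU u q a T →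
      ∀ (L : ℕ → ℝ) (ū : ℝ → (EuclideanSpace ℝ (Fin 3)) → (EuclideanSpace ℝ (Fin 3))), TangentU u q a T L ū →
        ∃ (U : ℝ → (EuclideanSpace ℝ (Fin 3)) → (EuclideanSpace ℝ (Fin 3))) (P : ℝ → (EuclideanSpace ℝ (Fin 3)) → ℝ), TowerObj M U P ∧
          ∀ R ∈ Ioo (0 : ℝ) 1,
            ∀ᵐ z ∂(volume.restrict (parabolicCylinder R (0 : ℝ × (EuclideanSpace ℝ (Fin 3))))), ū z.1 z.2 = U z.1 z.2

/-- (T1) **Closure** (target): tangent flows of tower objects are tower objects with the same rate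
`M` (tree engine `LocalTypeIBlowup.exists_typeIAncientMild_zoomLimit_seq` one level down + the
Wang–Zhang inheritance `blowup_cknC_le_apex` / `blowup_cknD_le_apex`). -/
def TowerClosed (M : ℝ) : Prop :=
  ∀ (U : ℝ → (EuclideanSpace ℝ (Fin 3)) → (EuclideanSpace ℝ (Fin 3))) (P : ℝ → (EuclideanSpace ℝ (Fin 3)) → ℝ), TowerObj M U P →
    ∀ (y' : (EuclideanSpace ℝ (Fin 3))) (L : ℕ → ℝ) (Ū : ℝ → (EuclideanSpace ℝ (Fin 3)) → (EuclideanSpace ℝ (Fin 3))), TangentU U P y' 0 L Ū →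
      ∃ (U' : ℝ → (EuclideanSpace ℝ (Fin 3)) → (EuclideanSpace ℝ (Fin 3))) (P' : ℝ → (EuclideanSpace ℝ (Fin 3)) → ℝ), TowerObj M U' P' ∧
        ∀ R ∈ Ioo (0 : ℝ) 1,
          ∀ᵐ z ∂(volume.restrict (parabolicCylinder R (0 : ℝ × (EuclideanSpace ℝ (Fin 3))))), Ū z.1 z.2 = U' z.1 z.2

/-- (T2) **Persistence down the tower** (target; A–B Prop 2.3 = tree `persistenceU_holds` after
`tshift`): at a satellite of a tower object, every tangent flow is singular at the origin. -/
def TowerPersists (M : ℝ) : Prop :=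
  ∀ (U : ℝ → (EuclideanSpace ℝ (Fin 3)) → (EuclideanSpace ℝ (Fin 3))) (P : ℝ → (EuclideanSpace ℝ (Fin 3)) → ℝ), TowerObj M U P →
    ∀ y' ∈ satellites U, ∀ (L : ℕ → ℝ) (Ū : ℝ → (EuclideanSpace ℝ (Fin 3)) → (EuclideanSpace ℝ (Fin 3))), TangentU U P y' 0 L Ū → ¬ RegPt Ū 0

/-- A node of the satellite tower: a velocity field, a pressure, a weak gradient and a chosen
final-time point. -/
structure TNode where
  /-- the velocity field -/
  U : ℝ → (EuclideanSpace ℝ (Fin 3)) → (EuclideanSpace ℝ (Fin 3))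
  /-- the pressure -/
  P : ℝ → (EuclideanSpace ℝ (Fin 3)) → ℝ
  /-- the weak spatial gradient -/
  H : ℝ → (EuclideanSpace ℝ (Fin 3)) → (EuclideanSpace ℝ (Fin 3)) →L[ℝ] (EuclideanSpace ℝ (Fin 3))
  /-- the chosen final-time point -/
  y : (EuclideanSpace ℝ (Fin 3))

/-- Admissible nodes: A–B objects (rate `M`) with the chosen point a satellite. -/
def TowerNode (M : ℝ) (n : TNode) : Prop := ABTower M n.U n.P n.H ∧ n.y ∈ satellites n.U

/-- Tame nodes: the slice budget of `n.U` holds at the satellite `n.y`. -/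
def TameNode (n : TNode) : Prop := TameSatellite n.U n.y

/-- `n` DESCENDS to `n'`: `n'.U` is, a.e. on every `Q_R(0)` with `R < 1`, a tangent flow of `n.U` at
`n.y`, and the new point `n'.y` lies in the open unit ball. -/
def Descends (n n' : TNode) : Prop :=
  ∃ (L : ℕ → ℝ) (Ū : ℝ → (EuclideanSpace ℝ (Fin 3)) → (EuclideanSpace ℝ (Fin 3))), TangentU n.U n.P n.y 0 L Ū ∧
    (∀ R ∈ Ioo (0 : ℝ) 1,
      ∀ᵐ z ∂(volume.restrict (parabolicCylinder R (0 : ℝ × (EuclideanSpace ℝ (Fin 3))))), Ū z.1 z.2 = n'.U z.1 z.2) ∧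
    ‖n'.y‖ < 1

/-- ROOTED nodes: admissible nodes that are singular at the origin. -/
def RootedNode (M : ℝ) (n : TNode) : Prop := TowerNode M n ∧ ¬ RegPt n.U 0

/-- A **ONE-SCAR LEAF** of rate `M`: a rooted `ABTower` field with NO satellite in the open unit
ball (the printed object class «local energy ancient solution singular at the origin», Seregin LN
Prop. 6.20 / Albritton–Barker Thm 1.1, with the extra one-scar property; no example is known and
its non-existence is open in print). -/
def OneScarLeaf (M : ℝ) : Prop :=
  ∃ (U : ℝ → (EuclideanSpace ℝ (Fin 3)) → (EuclideanSpace ℝ (Fin 3))) (P : ℝ → (EuclideanSpace ℝ (Fin 3)) → ℝ) (H : ℝ → (EuclideanSpace ℝ (Fin 3)) → (EuclideanSpace ℝ (Fin 3)) →L[ℝ] (EuclideanSpace ℝ (Fin 3))),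
    ABTower M U P H ∧ ¬ RegPt U 0 ∧ ∀ y : (EuclideanSpace ℝ (Fin 3)), y ≠ 0 → ‖y‖ < 1 → RegPt U y

/-- An **INFINITE ROOTED DESCENT** of rate `M`: an infinite chain of rooted, non-tame nodes, each
descending to the next (the census's second branch). -/
def InfiniteDescent (M : ℝ) : Prop :=
  ∃ c : ℕ → TNode, ∀ k, RootedNode M (c k) ∧ ¬ TameNode (c k) ∧ Descends (c k) (c (k + 1))


end Tower

end Summit.NavierStokesRegularity.NavierStokesRegularity.Cruxes.ScarEnvelopeTypeI.ZoomDictionary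

end
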